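import Mathlib

/-!
# F-multipliers of Hodge isomorphisms — the bilinear-algebra core of PROP. FR and LEMMA AN-F

Solo study `solo-HodgeConjecture-blind`, session s49 (work/s49/weil-b2-and-fface.md §0 (4)–(5), §1–§2).

Setting (abstracted): `V, V', V''` are modules over a commutative ring `R` with bilinear forms
`q, q', q''`; a linear map `Φ : V → V'` has *multiplier* `β : V →ₗ V` when
`q' (Φ x) (Φ y) = q (β x) y` for all `x, y` (for transcendental lattices of K3 surfaces with real
multiplication by a field `F ∋ β` this is an "`F`-similitude").  We certify:

* `adjoint_comp_eq_multiplier`: if `Ψ` is a `(q, q')`-adjoint of `Φ` and `q` is left-non-degenerate,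
  then `Ψ ∘ Φ = β` — so an algebraic `Φ` makes `β` (hence `ℚ[β]`) an algebraic self-correspondence
  (PROP. FR: the F-similarity face dominates the real-multiplication face).
* `comp_symm_isometry`: two isomorphisms `Φ₁ : V ≃ V'`, `Φ₂ : V ≃ V''` with the SAME multiplier differ by
  an isometry `Φ₂ ∘ Φ₁⁻¹ : V' → V''` (LEMMA AN-F, all-or-nothing for `F`-multipliers).
* `isometry_comp_multiplier`: post-composing with an isometry keeps the multiplier.
* `two_not_norm_local`: the 3-adic certificate behind "2 ∉ Nm ℚ(√-3)^×" used for the discriminant class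
  of the Weil sixfold `B″_f` (every solution of `a² + 3b² = 2c²` modulo 9 has `3 ∣ a, b, c`; infinite
  descent — not formalised here — then excludes non-zero integer solutions).

Everything is elementary; no geometry is formalised.
-/

namespace Summit.HodgeConjecture.HodgeConjecture.Theorems.FMultiplier

section Bilinear

variable {R : Type*} [CommRing R]
variable {V V' V'' : Type*} [AddCommGroup V] [Module R V] [AddCommGroup V'] [Module R V']
  [AddCommGroup V''] [Module R V'']

/-- If `Ψ` is adjoint to `Φ` (`q (Ψ y') x = q' y' (Φ x)`), `Φ` has multiplier `β`
(`q' (Φ x) (Φ y) = q (β x) y`) and `q` is left-non-degenerate, then `Ψ ∘ Φ = β`. -/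
theorem adjoint_comp_eq_multiplier
    (q : V →ₗ[R] V →ₗ[R] R) (q' : V' →ₗ[R] V' →ₗ[R] R)
    (Φ : V →ₗ[R] V') (Ψ : V' →ₗ[R] V) (β : V →ₗ[R] V)
    (hadj : ∀ (y' : V') (x : V), q (Ψ y') x = q' y' (Φ x))
    (hmul : ∀ x y : V, q' (Φ x) (Φ y) = q (β x) y)
    (hq : ∀ v : V, (∀ y : V, q v y = 0) → v = 0) :
    ∀ x : V, Ψ (Φ x) = β x := by
  intro x
  have h : ∀ y : V, q (Ψ (Φ x) - β x) y = 0 := by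
    intro y
    have h1 : q (Ψ (Φ x)) y = q' (Φ x) (Φ y) := hadj (Φ x) y
    have h2 : q' (Φ x) (Φ y) = q (β x) y := hmul x y
    rw [map_sub, LinearMap.sub_apply, h1, h2, sub_self]
  have := hq _ h
  exact sub_eq_zero.mp this

/-- Two isomorphisms out of `V` with the same multiplier `β` differ by an isometry
`Φ₂ ∘ Φ₁⁻¹ : (V', q') → (V'', q'')`. -/
theorem comp_symm_isometry
    (q : V →ₗ[R] V →ₗ[R] R) (q' : V' →ₗ[R] V' →ₗ[R] R) (q'' : V'' →ₗ[R] V'' →ₗ[R] R)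
    (Φ₁ : V ≃ₗ[R] V') (Φ₂ : V ≃ₗ[R] V'') (β : V →ₗ[R] V)
    (h₁ : ∀ x y : V, q' (Φ₁ x) (Φ₁ y) = q (β x) y)
    (h₂ : ∀ x y : V, q'' (Φ₂ x) (Φ₂ y) = q (β x) y) :
    ∀ a b : V', q'' (Φ₂ (Φ₁.symm a)) (Φ₂ (Φ₁.symm b)) = q' a b := by
  intro a b
  rw [h₂, ← h₁, LinearEquiv.apply_symm_apply, LinearEquiv.apply_symm_apply]

/-- Post-composition with an isometry `Ψ : (V', q') → (V'', q'')` preserves the multiplier. -/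
theorem isometry_comp_multiplier
    (q : V →ₗ[R] V →ₗ[R] R) (q' : V' →ₗ[R] V' →ₗ[R] R) (q'' : V'' →ₗ[R] V'' →ₗ[R] R)
    (Φ : V →ₗ[R] V') (Ψ : V' →ₗ[R] V'') (β : V →ₗ[R] V)
    (hΦ : ∀ x y : V, q' (Φ x) (Φ y) = q (β x) y)
    (hΨ : ∀ a b : V', q'' (Ψ a) (Ψ b) = q' a b) :
    ∀ x y : V, q'' (Ψ (Φ x)) (Ψ (Φ y)) = q (β x) y := by
  intro x y
  rw [hΨ, hΦ]

/-- The multiplier of a composite: if `Φ : V → V'` has multiplier `β` and `Φ' : V' → V''` has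
multiplier `β'`, and `β'` is intertwined by `Φ` with `γ : V →ₗ V` (`Φ (γ x) = β' (Φ x)`), then
`Φ' ∘ Φ` has multiplier `β ∘ γ`.  (For `F`-linear maps and `β' = Φ β' Φ⁻¹ ∈ F`: multipliers multiply.) -/
theorem comp_multiplier
    (q : V →ₗ[R] V →ₗ[R] R) (q' : V' →ₗ[R] V' →ₗ[R] R) (q'' : V'' →ₗ[R] V'' →ₗ[R] R)
    (Φ : V →ₗ[R] V') (Φ' : V' →ₗ[R] V'') (β γ : V →ₗ[R] V) (β' : V' →ₗ[R] V')
    (hΦ : ∀ x y : V, q' (Φ x) (Φ y) = q (β x) y)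
    (hΦ' : ∀ a b : V', q'' (Φ' a) (Φ' b) = q' (β' a) b)
    (hint : ∀ x : V, Φ (γ x) = β' (Φ x)) :
    ∀ x y : V, q'' (Φ' (Φ x)) (Φ' (Φ y)) = q (β (γ x)) y := by
  intro x y
  rw [hΦ', ← hint, hΦ]

end Bilinear

/-- 3-adic certificate: every solution of `a² + 3 b² = 2 c²` modulo `9` has `a, b, c ≡ 0 (mod 3)`.
By infinite descent (divide by 3 and repeat) the equation has no non-zero integer solution, i.e.
`2` is not a norm from `ℚ(√-3)`; hence the classes `±2` in `ℚ^×/Nm` are distinct from `±1`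
(work/s49 §2: the Weil sixfold `B″_f` is non-split). Only the finite local statement is certified. -/
theorem two_not_norm_local :
    ∀ a b c : ZMod 9, a ^ 2 + 3 * b ^ 2 = 2 * c ^ 2 →
      (3 ∣ a.val ∧ 3 ∣ b.val ∧ 3 ∣ c.val) := by
  decide

/-- Companion certificate for the other non-trivial class used in §2: `-1 ∉ Nm ℚ(√-3)^×` needs no
arithmetic (norms `a² + 3b²` are non-negative); recorded as the trivial real statement. -/
theorem neg_one_not_norm_real (a b : ℚ) : a ^ 2 + 3 * b ^ 2 ≠ -1 := by
  have h1 : (0 : ℚ) ≤ a ^ 2 := sq_nonneg a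
  have h2 : (0 : ℚ) ≤ b ^ 2 := sq_nonneg b
  intro h
  linarith

end Summit.HodgeConjecture.HodgeConjecture.Theorems.FMultiplier
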